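import Summits.NavierStokesRegularity.NavierStokesRegularity.Theses.OddMorawetz

/-!
# NavierStokesRegularity — route `OddMorawetz`, assembly

Settles `stmt-NavierStokesRegularity-1380` (assembly of route OddMorawetz):

  `OddMorawetzLocal → MorawetzKillsTypeI → NoTypeII → NoBlowupToClay → NavierStokesRegularity`

(the route decl `OddMorawetz.Assembly`). The hypothesis list is, in the same order, the hypothesis
list of the route's deciding theorem
`Summit.NavierStokesRegularity.NavierStokesRegularity.Theses.OddMorawetz.closes`; the proof below is
the same pure logic, written out so that it does not depend on that theorem:
`NoBlowupToClay` reduces Clay (A) to "every finite-energy classical solution on `[0,T)` from a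
rapidly decaying datum extends smoothly past `T`"; if such a solution `(u,p)` had no smooth
extension past `T` it would be a maximal smooth solution with lifespan `T`
(`Literature.Analysis.FluidPDE.IsMaximalSmoothSolution` is by definition
`IsClassicalNSSolutionOn (Ico 0 T) ∧ ¬ HasSmoothExtensionPast`), so `NoTypeII` gives the Type-I
rate `IsTypeIBlowup u T`, and then `MorawetzKillsTypeI`, fed with the witnesses `(k, m)` of
`OddMorawetzLocal`, produces a smooth extension past `T` — contradiction. Nothing here is new
mathematics; the open content lives in the cruxes `OddMorawetzLocal`, `MorawetzKillsTypeI` and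
`NoTypeII`.
-/

namespace Summit.NavierStokesRegularity.NavierStokesRegularity.Theorems

open Summit.NavierStokesRegularity.NavierStokesRegularity.Theses

/-- Assembly of route OddMorawetz (`stmt-NavierStokesRegularity-1380`):
`OddMorawetzLocal → MorawetzKillsTypeI → NoTypeII → NoBlowupToClay → NavierStokesRegularity`.
Pure logic: apply `NoBlowupToClay`; a classical Leray–Hopf solution from a rapidly decaying datum
with no smooth extension past `T` is maximal
(`IsMaximalSmoothSolution = classical ∧ ¬ HasSmoothExtensionPast`), `NoTypeII` makes it Type I, and
`MorawetzKillsTypeI` applied to the witnesses of `OddMorawetzLocal` extends it past `T`,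
contradiction. [folklore] -/
theorem oddMorawetz_assembly_proof : OddMorawetz.Assembly := by
  unfold OddMorawetz.Assembly
  intro hOdd hKill hII hClay
  apply hClay
  intro ν T hν hTpos u p hcl hLH hdec
  by_contra hext
  have hTI : Literature.Analysis.FluidPDE.IsTypeIBlowup u T :=
    hII ν T hν hTpos u p ⟨hcl, hext⟩ hLH hdec
  obtain ⟨k, m, hk, hsm, hhom, hbi, hQ, hpos⟩ := hOdd
  exact hext (hKill k m hk hsm hhom hbi hQ hpos ν T hν hTpos u p hcl hLH hdec hTI)

end Summit.NavierStokesRegularity.NavierStokesRegularity.Theorems
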